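import Literature.Analysis.FunctionSpaces.DiagonalWeakLimits
import Mathlib.Analysis.RCLike.Basic
import Mathlib.Analysis.Normed.Operator.Basic
import HarnessLib

/-!
# Sequential weak-* extraction for bounded functionals on countably many separable spaces

**Theorem (sequential Banach–Alaoglu, separable case, countable family).** Let `E i`
(`i ∈ ι`, `ι` countable) be separable normed spaces over `𝕜 = ℝ` or `ℂ`, and let
`T i n : E i →L[𝕜] 𝕜` (`n ∈ ℕ`) be functionals with `‖T i n x‖ ≤ C i ‖x‖`. Then ONE subsequence
`φ` and limit functionals `Λ i : E i →L[𝕜] 𝕜` with `‖Λ i x‖ ≤ C i ‖x‖` exist such that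
`T i (φ n) x → Λ i x` for every `i` and every `x` (Banach 1932, Ch. VIII §5 Thm. 3 for one
separable space; the countable family is Cantor's diagonal procedure). [folklore]

Proof: diagonal extraction on the countable set of pairs `(i, j)` through dense sequences
`(u i j)_j` of the `E i` (the values `T i n (u i j)` stay in the compact balls
`B̄(0, C i ‖u i j‖)`; the tree's `exists_strictMono_forall_tendsto`), extension of the
convergence from the dense sequences to all vectors by the uniform Lipschitz bound (the tree's
`forall_exists_tendsto_of_subset_closure`), and linearity/boundedness of the pointwise limits.
This is the compactness step for weak-* limits of uniformly bounded families of functionals on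
`C(K)` (order-zero distributions / Radon measures) used with Weyl's lemma
(`Literature/Analysis/Complex/WeylLemmaDbarFunctional.lean`).
-/

noncomputable section

open Filter Topology Set Metric

namespace Literature.Analysis.FunctionSpaces

/-- **Sequential weak-* extraction** for uniformly bounded functionals on countably many
separable normed spaces: one common subsequence along which all the functionals converge
pointwise to bounded linear limits with the same bounds (Banach 1932, VIII §5 Thm. 3, plus the
diagonal procedure). [folklore] -/
theorem exists_strictMono_weakStar_tendsto {𝕜 : Type*} [RCLike 𝕜] {ι : Type*} [Countable ι]
    (E : ι → Type*) [∀ i, NormedAddCommGroup (E i)] [∀ i, NormedSpace 𝕜 (E i)]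
    [∀ i, TopologicalSpace.SeparableSpace (E i)]
    (T : (i : ι) → ℕ → (E i →L[𝕜] 𝕜)) (C : ι → ℝ) (hC : ∀ i, 0 ≤ C i)
    (hT : ∀ i n x, ‖T i n x‖ ≤ C i * ‖x‖) :
    ∃ φ : ℕ → ℕ, StrictMono φ ∧ ∀ i, ∃ Λ : E i →L[𝕜] 𝕜,
      (∀ x, ‖Λ x‖ ≤ C i * ‖x‖) ∧ ∀ x, Tendsto (fun n => T i (φ n) x) atTop (𝓝 (Λ x)) := by
  classical
  -- dense sequences
  have hdense : ∀ i, ∃ u : ℕ → E i, DenseRange u := fun i => TopologicalSpace.exists_dense_seq (E i)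
  choose u hu using hdense
  -- diagonal extraction on the pairs `(i, j)`
  obtain ⟨φ, hφ, hlim⟩ := exists_strictMono_forall_tendsto (ι := Σ _ : ι, ℕ) (F := 𝕜)
    (fun n p => T p.1 n (u p.1 p.2)) fun p => ⟨0, C p.1 * ‖u p.1 p.2‖, fun n => by
      simpa [mem_closedBall, dist_zero_right] using hT p.1 n (u p.1 p.2)⟩
  refine ⟨φ, hφ, fun i => ?_⟩
  -- convergence at every vector of `E i`
  have hall : ∀ t ∈ (univ : Set (E i)), ∃ l, Tendsto (fun n => T i (φ n) t) atTop (𝓝 l) := by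
    refine forall_exists_tendsto_of_subset_closure (x := fun n t => T i (φ n) t)
      (D := range (u i)) (by rw [(hu i).closure_range]) ?_ ?_
    · rintro d ⟨j, rfl⟩
      exact hlim ⟨i, j⟩
    · intro ε hε
      have hC1 : 0 < C i + 1 := by linarith [hC i]
      refine ⟨ε / (C i + 1), div_pos hε hC1, fun n t _ d _ htd => ?_⟩
      rw [dist_eq_norm, ← map_sub]
      calc ‖T i (φ n) (t - d)‖ ≤ C i * ‖t - d‖ := hT i (φ n) _
        _ ≤ (C i + 1) * ‖t - d‖ := by gcongr; linarith
        _ < (C i + 1) * (ε / (C i + 1)) := by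
            rw [← dist_eq_norm]; exact mul_lt_mul_of_pos_left htd hC1
        _ = ε := by field_simp
  choose L hL using fun t => hall t (mem_univ t)
  -- the limit is linear and bounded
  have hadd : ∀ s t, L (s + t) = L s + L t := fun s t =>
    tendsto_nhds_unique (hL (s + t)) (by simpa only [map_add] using (hL s).add (hL t))
  have hsmul : ∀ (c : 𝕜) t, L (c • t) = c • L t := fun c t =>
    tendsto_nhds_unique (hL (c • t)) (by simpa only [map_smul] using (hL t).const_smul c)
  have hbound : ∀ t, ‖L t‖ ≤ C i * ‖t‖ := fun t =>
    le_of_tendsto' ((continuous_norm.tendsto _).comp (hL t)) fun n => hT i (φ n) t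
  let Llin : E i →ₗ[𝕜] 𝕜 := { toFun := L, map_add' := hadd, map_smul' := hsmul }
  refine ⟨Llin.mkContinuous (C i) hbound, fun x => hbound x, fun x => hL x⟩

end Literature.Analysis.FunctionSpaces

end
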